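import Literature.NumberTheory.LFunctions.DobnerSelbergClassFourierInversionProofs
import Literature.NumberTheory.LFunctions.DobnerSelbergClassKernelProofs
import Literature.NumberTheory.LFunctions.DobnerSelbergClassZeroFreeProofs
import Literature.NumberTheory.LFunctions.DobnerSelbergClassTheorem1Proofs
import Literature.NumberTheory.LFunctions.DobnerSelbergClassTheorem2Proofs
import HarnessLib

/-!
# Dobner, Thm. 1 for `F ∈ 𝒮♯`: the strip for `H_0` (node T1-STRIP) and the final assembly
`dobner_theorem1_holds` (T1 leaf)

RH-FREE literature PROOFS (no definitions, no named facts). Trunk T-ANT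
(`Literature/NumberTheory/LFunctions`); node **T1-STRIP** of the plan of record for the discharge of
`Literature.NumberTheory.LFunctions.dobner_theorem1` (rt-lead ruling (32), rt/STATUS 2026-08-26):
the assembly of its two halves, (c) Fourier inversion `H_0(z) = Ξ((1+iz)/2)`
(`DobnerSelbergClassFourierInversionProofs.lean`, hypothesis form) and (d) the zero-free right
half-plane of `F` ⇒ zeros of the entire `ξ^F` in a vertical strip
(`DobnerSelbergClassZeroFreeProofs.lean`, `ExtendedSelbergDatum.exists_rootsInStrip_Ht_zero_of`),
with the analytic inputs `Φ_F ∈ L¹` and `H_0` entire of `DobnerSelbergClassKernelProofs.lean`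
(`ExtendedSelbergDatum.integrable_Phi`, `ExtendedSelbergDatum.differentiable_Ht_all`); then the
LEAF of the T1 pipeline (rt-lead rulings (32)/(35)/(38)): Dobner's **Thm. 1** for the extended
Selberg class, `dobner_theorem1_holds`, from rt-iso's reduction `dobner_theorem1_of`
(`DobnerSelbergClassTheorem1Proofs.lean`: de Bruijn admissibility + strip + Thm. 2 ⇒ Thm. 1), t4's
admissibility of `Φ_F` (`ExtendedSelbergDatum.isAdmissible_Phi`, `DobnerSelbergClassKernelProofs.lean`),
this file's strip, and Thm. 2 (`dobner_theorem2_holds`, `DobnerSelbergClassTheorem2Proofs.lean`).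

> A. Dobner, *A proof of Newman's conjecture for the extended Selberg class*, Acta Arith. 201
> (2021) 29–62 = arXiv:2005.05142, proof of Thm. 1, pp. 6–7: «since `F` is non-vanishing in some
> right half-plane, the zeros of `ξ^F` lie in a vertical strip, so the zeros of
> `H_0(z) = ξ^F((1+iz)/2)` lie in a horizontal strip `|Im z| ≤ Δ`».

## Main results (`D : ExtendedSelbergDatum`, `k = D.numGamma ≥ 1`)

* `ExtendedSelbergDatum.Ht_zero_eq_entire` — `H_0(z) = Ξ((1+iz)/2)` on `ℂ` for every entire model
  `Ξ` of `ξ^F` (hypothesis-free form of `Ht_zero_eq_entire_of`).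
* `ExtendedSelbergDatum.exists_rootsInStrip_Ht_zero` — **T1-STRIP** (frozen signature, rt-iso
  rt/STATUS 2026-08-26T09:13:36Z): `∃ Δ ≥ 0, RootsInStrip (D.Ht 0) Δ`.
* `dobner_theorem1_holds : dobner_theorem1` — **Dobner's Thm. 1 for `F ∈ 𝒮♯`** (`k ≥ 1`): there is
  `Λ_F` with `H_t` having only real zeros iff `t ≥ Λ_F`; and `ExtendedSelbergDatum.dbnConst_nonneg_holds`
  — the literal **`Λ_F ≥ 0`** (Thm. 2 as printed) with both inputs discharged.

LABEL: RH-FREE CONTENT (0 facts). bears_on: N-C/N-P (COLUMN 3 DBN).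
WHAT THIS IS NOT: a strip localisation of the zeros of the de Bruijn transform of `ξ^F`, input of
the RH-free existence theorem for `Λ_F` (`F ∈ 𝒮♯`); nothing here bears on the truth of RH.
-/

noncomputable section

open Complex
open scoped ComplexConjugate

namespace Literature.NumberTheory.LFunctions

namespace ExtendedSelbergDatum

variable (D : ExtendedSelbergDatum)

/-- **`H_0(z) = Ξ((1+iz)/2)` on `ℂ`** for every entire `Ξ` agreeing with `ξ^F` on
`{Re s > 0} ∖ {1}` (`k ≥ 1`): `Ht_zero_eq_entire_of` with `Φ_F ∈ L¹` (`integrable_Phi`) and `H_0`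
entire (`differentiable_Ht_all`). [cite: Dobner2021, §2 p. 6 and proof of Thm. 1 p. 6] -/
theorem Ht_zero_eq_entire (hk : 0 < D.numGamma) :
    ∀ Ξ : ℂ → ℂ, Differentiable ℂ Ξ → (∀ s : ℂ, 0 < s.re → s ≠ 1 → Ξ s = D.xi s) →
      (∀ s : ℂ, Ξ s = conj (Ξ (1 - conj s))) → ∀ z : ℂ, D.Ht 0 z = Ξ ((1 + I * z) / 2) :=
  D.Ht_zero_eq_entire_of hk (D.integrable_Phi hk) (D.differentiable_Ht_all hk 0)

/-- **T1-STRIP — the roots of `H_0` lie in a horizontal strip** (`k ≥ 1`): there is `Δ ≥ 0` with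
`RootsInStrip (D.Ht 0) Δ` (proof of Thm. 1, pp. 6–7: zero-free right half-plane of `F`, the
functional equation of the entire `ξ^F`, and `H_0(z) = ξ^F((1+iz)/2)`).
[cite: Dobner2021, proof of Thm. 1, pp. 6–7] -/
theorem exists_rootsInStrip_Ht_zero (hk : 0 < D.numGamma) :
    ∃ Δ : ℝ, 0 ≤ Δ ∧ Literature.Analysis.Complex.RootsInStrip (D.Ht 0) Δ :=
  D.exists_rootsInStrip_Ht_zero_of hk (D.Ht_zero_eq_entire hk)

end ExtendedSelbergDatum

/-! ## Dobner's Theorem 1 for the extended Selberg class -/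

/-- **DISCHARGE of `dobner_theorem1` — Dobner 2021, Thm. 1** («For every `F ∈ 𝒮♯` there is a real
`Λ_F` such that `H_t` has only real zeros if and only if `t ≥ Λ_F`», p. 3; proof pp. 6–7): de
Bruijn admissibility of `Φ_F` (`ExtendedSelbergDatum.isAdmissible_Phi`), the strip for `H_0`
(`ExtendedSelbergDatum.exists_rootsInStrip_Ht_zero`), Thm. 2 (`dobner_theorem2_holds`), assembled
by `dobner_theorem1_of` (de Bruijn's Thm. 13, Hurwitz closure of `𝒵`). RH-FREE CONTENT.
[cite: Dobner2021, Thm. 1 p. 3 (proof pp. 6–7)] -/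
theorem dobner_theorem1_holds : dobner_theorem1 :=
  dobner_theorem1_of (fun D hk ↦ D.isAdmissible_Phi hk) (fun D hk ↦ D.exists_rootsInStrip_Ht_zero hk)
    dobner_theorem2_holds

/-- **`Λ_F ≥ 0` for every `F ∈ 𝒮♯` with `k ≥ 1`** — Dobner's Thm. 2 as printed (p. 3), with both of
its tree inputs (Thm. 1, Thm. 2) discharged. [cite: Dobner2021, Thm. 2 p. 3] -/
theorem ExtendedSelbergDatum.dbnConst_nonneg_holds (D : ExtendedSelbergDatum) (hk : 0 < D.numGamma) :
    0 ≤ D.dbnConst :=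
  D.dbnConst_nonneg dobner_theorem1_holds dobner_theorem2_holds hk

end Literature.NumberTheory.LFunctions

end
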